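import Literature.Geometry.Lorentzian.HopfPositivity
import Literature.Geometry.Lorentzian.HessianLocalMax
import Literature.Geometry.Lorentzian.CurvatureRegularity
import Literature.Geometry.Lorentzian.MetricNormSq
import Literature.Geometry.Riemannian.GradientShrinkerProofs
import Literature.Geometry.Riemannian.WeightedHeatFlowFromLinearHeat
import HarnessLib

/-!
# `R > 0` on a closed four-dimensional gradient shrinking soliton
(stub `stub_scalarCurvaturePos_of_identities` of line `cgy-variance-pivot`, crux
`EntropyRung.CompactShrinkerGap`, item stmt-SmoothPoincare4-10870)

For a Riemannian metric `g` (Levi-Civita connection) on a closed `4`-manifold and a smooth `f`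
with `Ric + Hess f = g/2`, GIVEN the pointwise identity
(B) `ΔR = g⁻¹(dR, df) + R − 2|Ric|²` (landed separately as `stub_shrinkerScalarIdentities`),
the scalar curvature is positive: `R > 0` (Ivey 1993; B.-L. Chen 2009, Cor. 2.5;
Eminenti–La Nave–Mantegazza 2008, Prop. 2.2 — there for complete shrinkers; here the closed case).

Proof.
1. `R ≥ 0`: `R` is smooth (`contMDiff_scalarCurvature`) and `M` is compact, so `R` attains its
   minimum at some `x₀`; there `dR = 0` (Fermat) and `ΔR ≥ 0` (`dalembertian_nonneg_of_isLocalMin`),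
   whence by (B) `R(x₀) = ΔR(x₀) + 2|Ric|²(x₀) ≥ 0` (`|Ric|²_g ≥ 0` for Riemannian `g`,
   `normSq_nonneg`).
2. The zero set `Z = {R = 0}` is open. Instead of a strong minimum principle with drift we
   CONJUGATE the drift away: for `u = e^{-f/2} R` the product and chain rules
   (`dalembertian_fun_mul`, `dalembertian_real_comp`) and (B) give
   `Δu = e^{-f/2}(ΔR − g⁻¹(dR, df) + R(|∇f|²/4 − Δf/2)) = e^{-f/2}(R − 2|Ric|² + R(|∇f|²/4 − Δf/2))`,
   and with the traced soliton equation `Δf = 2 − R`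
   (`IsGradientShrinker.scalarCurvature_add_dalembertian_one`, `finrank ℝ ℝ⁴ = 4`)
   `Δu = (R/2 + |∇f|²/4) u − 2e^{-f/2}|Ric|² ≤ c u`, `c = R/2 + |∇f|²/4 ≥ 0` continuous. As
   `u ≥ 0` and `u = 0` exactly on `Z`, E. Hopf's minimum principle for `Δ_g − c`
   (`dalembertian_supersolution_eventually_eq`, López-Gómez 2012, Thm. 1.2) makes `Z` open.
3. `Z` is closed, hence compact. If `Z ≠ ∅`, `f|_Z` attains its maximum at some `p ∈ Z`; `Z`
   being open, `p` is a local maximum of `f` on `M`, so `Δf(p) ≤ 0`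
   (`dalembertian_nonpos_of_isLocalMax`) — contradicting `Δf(p) = 2 − R(p) = 2`. Hence `Z = ∅`.
   (No connectedness of `M` is needed.)

Everything is proved; no definition, no named fact.

References: B.-L. Chen, *Strong uniqueness of the Ricci flow*, J. Differential Geom. 82 (2009),
Cor. 2.5 [Chen2007]; M. Eminenti, G. La Nave, C. Mantegazza, *Ricci solitons: the equation point
of view*, Manuscripta Math. 127 (2008), Prop. 2.2 [EminentiNaveMantegazza2006]; J. López-Gómez,
*Linear Second Order Elliptic Operators* (2012), Thm. 1.2 [LopezGomez2012].
-/

noncomputable section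

-- the registered namespace `Summit.SmoothPoincare4.SmoothPoincare4.Theorems` repeats a component
set_option linter.dupNamespace false

open Bundle Set Function Filter Module
open scoped Manifold ContDiff Topology

namespace Summit.SmoothPoincare4.SmoothPoincare4.Theorems

open Literature.Geometry Literature.Geometry.Lorentzian Literature.Geometry.Riemannian
  Literature.Geometry.Lorentzian.PseudoRiemannianMetric

section Conjugation

variable {M : Type*} [TopologicalSpace M] [ChartedSpace (EuclideanSpace ℝ (Fin 4)) M]
  [IsManifold (𝓡 4) ∞ M]
  (g : PseudoRiemannianMetric (𝓡 4) ∞ (EuclideanSpace ℝ (Fin 4)) (TangentSpace (𝓡 4) : M → Type _))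
  [g.HasLeviCivita]

/-- The derivative of `ζ(s) = e^{-s/2}` is `ζ'(t) = e^{-t/2} · (−½)`. [folklore] -/
private theorem hasDerivAt_expNegHalf (t : ℝ) :
    HasDerivAt (fun s : ℝ ↦ Real.exp (-s / 2)) (Real.exp (-t / 2) * (-1 / 2)) t :=
  (((hasDerivAt_id t).neg).div_const 2).exp

/-- **The conjugated supersolution** (step 2 of the proof of B.-L. Chen 2009, Cor. 2.5 in the
closed case, with the drift conjugated away). For a Riemannian `g`, a smooth `f` with
`Δf = 2 − R`, and the identity (B) `ΔR = g⁻¹(dR, df) + R − 2|Ric|²`, the function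
`u = e^{-f/2} R` satisfies `Δ_g u ≤ (R/2 + |∇f|²/4) · u` pointwise: by the product rule
`Δ(aR) = aΔR + RΔa + 2g⁻¹(da, dR)` and the chain rule `Δe^{-f/2} = e^{-f/2}(|∇f|²/4 − Δf/2)`,
`de^{-f/2} = −½e^{-f/2}df`, one gets `Δu = (R/2 + |∇f|²/4)u − 2e^{-f/2}|Ric|²`, and `|Ric|²_g ≥ 0`.
[cite: Chen2007, Cor. 2.5] -/
private theorem dalembertian_expMul_scalarCurvature_le (hg : g.IsRiemannian) {f : M → ℝ}
    (hf : ContMDiff (𝓡 4) 𝓘(ℝ, ℝ) ∞ f)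
    (hΔf : ∀ x, g.dalembertian f x = 2 - g.scalarCurvature x)
    (hB : ∀ x : M, g.dalembertian g.scalarCurvature x =
        g.innerDual x (mvfderiv (𝓡 4) g.scalarCurvature x : TangentSpace (𝓡 4) x →ₗ[ℝ] ℝ)
            (mvfderiv (𝓡 4) f x : TangentSpace (𝓡 4) x →ₗ[ℝ] ℝ) +
          g.scalarCurvature x - 2 * g.normSq x (g.ricci x)) (x : M) :
    g.dalembertian (fun y ↦ Real.exp (-f y / 2) * g.scalarCurvature y) x ≤
      (g.scalarCurvature x / 2 + g.gradSq f x / 4) * (Real.exp (-f x / 2) * g.scalarCurvature x) := by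
  -- regularity at `x`
  have hf2 : ContMDiffAt (𝓡 4) 𝓘(ℝ, ℝ) 2 f x :=
    (hf.of_le (WithTop.coe_le_coe.mpr le_top)).contMDiffAt
  have hfd : MDifferentiableAt (𝓡 4) 𝓘(ℝ, ℝ) f x := hf2.mdifferentiableAt (by norm_num)
  have hR2 : ContMDiffAt (𝓡 4) 𝓘(ℝ, ℝ) 2 g.scalarCurvature x :=
    (g.contMDiff_scalarCurvature.of_le (WithTop.coe_le_coe.mpr le_top)).contMDiffAt
  have hζ : ContDiff ℝ 2 (fun s : ℝ ↦ Real.exp (-s / 2)) :=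
    Real.contDiff_exp.comp (contDiff_neg.div_const 2)
  have hA2 : ContMDiffAt (𝓡 4) 𝓘(ℝ, ℝ) 2 (fun y ↦ Real.exp (-f y / 2)) x :=
    hζ.contDiffAt.comp_contMDiffAt hf2
  -- the derivatives of `ζ(s) = e^{-s/2}`
  have hd1 : deriv (fun s : ℝ ↦ Real.exp (-s / 2)) = fun t ↦ Real.exp (-t / 2) * (-1 / 2) :=
    funext fun t ↦ (hasDerivAt_expNegHalf t).deriv
  have hd2 : deriv (deriv fun s : ℝ ↦ Real.exp (-s / 2)) (f x) =
      Real.exp (-f x / 2) * (-1 / 2) * (-1 / 2) := by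
    rw [hd1]
    exact ((hasDerivAt_expNegHalf (f x)).mul_const (-1 / 2)).deriv
  -- `Δ e^{-f/2}` (chain rule) and `d e^{-f/2}`
  have hΔA : g.dalembertian (fun y ↦ Real.exp (-f y / 2)) x =
      Real.exp (-f x / 2) * (-1 / 2) * (-1 / 2) * g.gradSq f x +
        Real.exp (-f x / 2) * (-1 / 2) * g.dalembertian f x := by
    have h1 := g.dalembertian_real_comp (ζ := fun s : ℝ ↦ Real.exp (-s / 2)) hf2 hζ.contDiffAt
    rw [show (fun y ↦ Real.exp (-f y / 2)) = (fun s : ℝ ↦ Real.exp (-s / 2)) ∘ f from rfl, h1,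
      hd2, hd1]
    rfl
  have hdA : (mvfderiv (𝓡 4) (fun y ↦ Real.exp (-f y / 2)) x : TangentSpace (𝓡 4) x →ₗ[ℝ] ℝ) =
      (Real.exp (-f x / 2) * (-1 / 2)) •
        (mvfderiv (𝓡 4) f x : TangentSpace (𝓡 4) x →ₗ[ℝ] ℝ) := by
    ext v
    simp only [ContinuousLinearMap.coe_coe, LinearMap.smul_apply, smul_eq_mul]
    exact mvfderiv_real_comp_apply (I := 𝓡 4) (hasDerivAt_expNegHalf (f x)) hfd v
  -- the product rule, then (B), `Δf = 2 − R` and `|Ric|² ≥ 0`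
  have ha : 0 < Real.exp (-f x / 2) := Real.exp_pos _
  have hQ : 0 ≤ g.normSq x (g.ricci x) := g.normSq_nonneg x hg _
  rw [dalembertian_fun_mul g hA2 hR2, hΔA, hdA, g.innerDual_smul_left,
    g.innerDual_comm x (mvfderiv (𝓡 4) f x : TangentSpace (𝓡 4) x →ₗ[ℝ] ℝ), hB x, hΔf x]
  nlinarith [mul_nonneg ha.le hQ]

end Conjugation

/-- **STUB `stub_scalarCurvaturePos_of_identities` of line `cgy-variance-pivot` — positivity of
the scalar curvature of a closed gradient shrinker from the pointwise identity.** On a closed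
4-manifold with Riemannian `g` (Levi-Civita), smooth `f`, `Ric + Hess f = g/2`, and GIVEN
(B) `ΔR = g⁻¹(dR, df) + R − 2|Ric|²` for this `(g, f)`: `R > 0` everywhere. Proof: at a global
minimum `x₀` of `R` (compactness; `R` is smooth, `contMDiff_scalarCurvature`) `ΔR ≥ 0` and
`dR = 0` (`dalembertian_nonneg_of_isLocalMin`), so `R_min = ΔR + 2|Ric|² ≥ 0`
(`normSq_nonneg`); the zero set `{R = 0}` is closed, and OPEN by E. Hopf's local minimum
principle (`dalembertian_supersolution_eventually_eq`, López-Gómez 2012 Thm. 1.2) applied to the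
conjugated function `u = e^{-f/2} R ≥ 0`, which satisfies `Δu ≤ (R/2 + |∇f|²/4) u`
(`dalembertian_expMul_scalarCurvature_le`: the conjugation removes the drift `g⁻¹(dR, df)`, and
`Δf = 2 − R` by the traced soliton equation); on the compact open set `{R = 0}`, if nonempty, `f`
attains a maximum at a point `p`, a local maximum of `f` in `M`, where `Δf(p) ≤ 0`
(`dalembertian_nonpos_of_isLocalMax`) contradicts `Δf(p) = 2 − R(p) = 2`. Ivey 1993;
B.-L. Chen 2009, Cor. 2.5; Eminenti–La Nave–Mantegazza 2008, Prop. 2.2.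
[cite: Chen2007, Cor. 2.5] [cite: EminentiNaveMantegazza2006, Prop. 2.2] -/
theorem stub_scalarCurvaturePos_of_identities :
    ∀ (M : Type) [TopologicalSpace M] [T2Space M] [SecondCountableTopology M]
      [ChartedSpace (EuclideanSpace ℝ (Fin 4)) M] [IsManifold (𝓡 4) ∞ M] [CompactSpace M]
      (g : Literature.Geometry.Lorentzian.PseudoRiemannianMetric (𝓡 4) ∞ (EuclideanSpace ℝ (Fin 4))
        (TangentSpace (𝓡 4) : M → Type _)) [g.HasLeviCivita] (f : M → ℝ), g.IsRiemannian →
      ContMDiff (𝓡 4) 𝓘(ℝ, ℝ) ∞ f →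
      (∀ (x : M) (X Y : TangentSpace (𝓡 4) x),
        g.ricci x X Y + g.hessian f x X Y = (1 / 2 : ℝ) * g.val x X Y) →
      (∀ x : M, g.dalembertian g.scalarCurvature x =
        g.innerDual x (mvfderiv (𝓡 4) g.scalarCurvature x : TangentSpace (𝓡 4) x →ₗ[ℝ] ℝ)
            (mvfderiv (𝓡 4) f x : TangentSpace (𝓡 4) x →ₗ[ℝ] ℝ) +
          g.scalarCurvature x - 2 * g.normSq x (g.ricci x)) →
      ∀ x : M, 0 < g.scalarCurvature x := by
  intro M _ _ _ _ _ _ g _ f hg hf hsol hB x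
  -- regularity and the traced soliton equation `Δf = 2 − R`
  have hRs : ContMDiff (𝓡 4) 𝓘(ℝ, ℝ) ∞ g.scalarCurvature := g.contMDiff_scalarCurvature
  have hR2 : ContMDiff (𝓡 4) 𝓘(ℝ, ℝ) 2 g.scalarCurvature :=
    hRs.of_le (WithTop.coe_le_coe.mpr le_top)
  have hRc : Continuous g.scalarCurvature := hRs.continuous
  have hf1 : ContMDiff (𝓡 4) 𝓘(ℝ, ℝ) 1 f := hf.of_le (by norm_num)
  have hf2 : ContMDiff (𝓡 4) 𝓘(ℝ, ℝ) 2 f := hf.of_le (WithTop.coe_le_coe.mpr le_top)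
  have hE : finrank ℝ (EuclideanSpace ℝ (Fin 4)) = 4 := finrank_euclideanSpace_fin
  have hshr : g.IsGradientShrinker f 1 := (g.isGradientShrinker_one_iff f).2 hsol
  have hΔf : ∀ y, g.dalembertian f y = 2 - g.scalarCurvature y := fun y ↦ by
    have h := hshr.scalarCurvature_add_dalembertian_one y
    rw [hE] at h
    norm_num at h
    linarith
  have hpos : ∀ (y : M) (v : TangentSpace (𝓡 4) y), v ≠ 0 → 0 < g.val y v v :=
    fun y v hv ↦ hg y v hv
  have hQ : ∀ y, 0 ≤ g.normSq y (g.ricci y) := fun y ↦ g.normSq_nonneg y hg _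
  -- (1) `R ≥ 0`: at a global minimum `x₀`, `ΔR ≥ 0` and `dR = 0`, so `R = ΔR + 2|Ric|² ≥ 0` by (B)
  have hR0 : ∀ y, 0 ≤ g.scalarCurvature y := by
    obtain ⟨x₀, -, hmin⟩ := isCompact_univ.exists_isMinOn ⟨x, mem_univ x⟩ hRc.continuousOn
    have hloc : IsLocalMin g.scalarCurvature x₀ :=
      Filter.Eventually.of_forall fun y ↦ hmin (mem_univ y)
    have hΔ : 0 ≤ g.dalembertian g.scalarCurvature x₀ :=
      g.dalembertian_nonneg_of_isLocalMin (hR2 x₀) hloc (hpos x₀)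
    have hcrit : mfderiv (𝓡 4) 𝓘(ℝ, ℝ) g.scalarCurvature x₀ = 0 :=
      Literature.Topology.FourManifolds.IsLocalMin.isMCriticalPt hloc
    have hd : mvfderiv (𝓡 4) g.scalarCurvature x₀ = 0 := by
      ext v
      simp [mvfderiv, hcrit]
    have hI : g.innerDual x₀
        (mvfderiv (𝓡 4) g.scalarCurvature x₀ : TangentSpace (𝓡 4) x₀ →ₗ[ℝ] ℝ)
        (mvfderiv (𝓡 4) f x₀ : TangentSpace (𝓡 4) x₀ →ₗ[ℝ] ℝ) = 0 := by
      simp [PseudoRiemannianMetric.innerDual, hd]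
    have hBx := hB x₀
    rw [hI] at hBx
    intro y
    have h1 : g.scalarCurvature x₀ ≤ g.scalarCurvature y := hmin (mem_univ y)
    linarith [hQ x₀]
  -- (2) the zero set of `R` is open: Hopf's minimum principle for `u = e^{-f/2} R ≥ 0`,
  -- `Δu ≤ (R/2 + |∇f|²/4) u`
  have hopen : IsOpen {y : M | g.scalarCurvature y = 0} := by
    have hζ : ContDiff ℝ 2 (fun s : ℝ ↦ Real.exp (-s / 2)) :=
      Real.contDiff_exp.comp (contDiff_neg.div_const 2)
    have hu2 : ContMDiff (𝓡 4) 𝓘(ℝ, ℝ) 2 (fun y ↦ Real.exp (-f y / 2) * g.scalarCurvature y) :=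
      (hζ.comp_contMDiff hf2).mul hR2
    have hGc : Continuous (g.gradSq f) := continuous_innerDual_mvfderiv g hf1 hf1
    have hcc : Continuous fun y ↦ g.scalarCurvature y / 2 + g.gradSq f y / 4 :=
      (hRc.div_const 2).add (hGc.div_const 4)
    have hc0 : ∀ y, 0 ≤ g.scalarCurvature y / 2 + g.gradSq f y / 4 := fun y ↦
      add_nonneg (div_nonneg (hR0 y) (by norm_num)) (div_nonneg (g.gradSq_nonneg hg f y) (by norm_num))
    have hu0 : ∀ y, (0 : ℝ) ≤ Real.exp (-f y / 2) * g.scalarCurvature y := fun y ↦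
      mul_nonneg (Real.exp_pos _).le (hR0 y)
    rw [isOpen_iff_mem_nhds]
    intro x₁ hx₁
    have hux₁ : Real.exp (-f x₁ / 2) * g.scalarCurvature x₁ = 0 := by
      rw [show g.scalarCurvature x₁ = 0 from hx₁, mul_zero]
    have hev := g.dalembertian_supersolution_eventually_eq hg hcc hc0 hu2
      (fun y ↦ dalembertian_expMul_scalarCurvature_le g hg hf hΔf hB y) le_rfl hu0 hux₁
    refine mem_of_superset hev fun y hy ↦ ?_
    have hy' : Real.exp (-f y / 2) * g.scalarCurvature y = 0 := hy
    exact (mul_eq_zero.1 hy').resolve_left (Real.exp_pos _).ne'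
  -- (3) on the compact open zero set, `Δf = 2` contradicts `Δf ≤ 0` at a maximum point of `f`
  by_contra hxneg
  have hx0 : g.scalarCurvature x = 0 := le_antisymm (not_lt.1 hxneg) (hR0 x)
  have hZc : IsClosed {y : M | g.scalarCurvature y = 0} := isClosed_eq hRc continuous_const
  obtain ⟨p, hpZ, hpmax⟩ := hZc.isCompact.exists_isMaxOn ⟨x, hx0⟩ hf.continuous.continuousOn
  have hploc : IsLocalMax f p := hpmax.isLocalMax (hopen.mem_nhds hpZ)
  have h1 : g.dalembertian f p ≤ 0 := g.dalembertian_nonpos_of_isLocalMax (hf2 p) hploc (hpos p)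
  have h2 := hΔf p
  rw [show g.scalarCurvature p = 0 from hpZ] at h2
  linarith

end Summit.SmoothPoincare4.SmoothPoincare4.Theorems

end
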